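import Mathlib.Data.Nat.Choose.Basic
import Mathlib.Algebra.BigOperators.Intervals
import Mathlib.Algebra.Order.BigOperators.Group.Finset
import Mathlib.Tactic
import Summits.CriticalPhenomena.PercolationContinuityZ3.Theorems.PercNearOneGluingNoHeavyLowerTailULCTwo
import HarnessLib

/-!
# THEOREM U-LC for small shifts: log-concavity of `C(L,t) + C(L,t-j)` by induction on `L`

Support file for the Sahi / Conjecture-P programme of route `PercNearOneGluingNoHeavy`
(`--supports stmt-CriticalPhenomena-4575`, prover prim-l12-p5 gen 28; proof note
`prim-l12-p5/U-STRUCTURE-g28.md` §3, §6).  No definitions, no named facts, no sorries.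

`ULCKappa.u_lc_kappa` proves CONJECTURE U (hence TEST(j)) for all symmetric unimodal tilts whenever the
two-bump sequence `Φ_j^{(L)}(t) = C(L,t) + C(L,t-j)` is two-point log-concave, which holds iff `j² ≤ L+3`.
Pascal's rule gives `Φ_j^{(L+1)}(t) = Φ_j^{(L)}(t) + Φ_j^{(L)}(t-1)`, a window sum of width two, so by
`ULCTwo.window_lc2` two-point log-concavity PROPAGATES from `L` to `L+1`; it therefore suffices to check the
base `L₀ = j²-3`, a finite computation.  This file proves

* `phi_succ`, `phi_lc2_succ`, `phi_lc2_of_base` : the propagation `L → L+1` and the induction;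
* `phi_lc2_three` (base `L₀ = 6`, by `decide`), `phi_lc2_four` (base `L₀ = 13`);
* `u_lc_kappa_three` (`L ≥ 6`), `u_lc_kappa_four` (`L ≥ 13`) : THEOREM U-LC unconditional for `j = 3, 4`
  (the tilted TEST(3), TEST(4) inequalities for all symmetric unimodal tilts in the regime `j² ≤ L+3`).
-/

namespace Summit.CriticalPhenomena.PercolationContinuityZ3.Theorems

namespace ULCSmallJ

open Finset

/-- Pascal for the two-bump sequence: `Φ_j^{(L+1)}(t) = ∑_{s<2} Φ_j^{(L)}(t-s)` (guarded window sum). -/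
theorem phi_succ (L j t : ℕ) :
    (((L + 1).choose t : ℝ) + (if j ≤ t then ((L + 1).choose (t - j) : ℝ) else 0)) =
      ∑ s ∈ range (1 + 1), (if s ≤ t then
        ((L.choose (t - s) : ℝ) + (if j ≤ t - s then (L.choose (t - s - j) : ℝ) else 0)) else 0) := by
  simp only [sum_range_succ, sum_range_zero, zero_add, Nat.zero_le, if_true, Nat.sub_zero]
  rcases Nat.eq_zero_or_pos t with ht | ht
  · subst ht
    simp
  · obtain ⟨r, rfl⟩ : ∃ r, t = r + 1 := ⟨t - 1, by omega⟩
    have e1 : r + 1 - 1 = r := by omega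
    simp only [e1, show (1 : ℕ) ≤ r + 1 from by omega, if_true]
    rw [Nat.choose_succ_succ' L r]
    by_cases hj : j ≤ r + 1
    · by_cases hj' : j ≤ r
      · have e2 : r + 1 - j = (r - j) + 1 := by omega
        simp only [hj, hj', if_true, e2]
        rw [Nat.choose_succ_succ' L (r - j)]
        push_cast
        ring
      · have hjr : j = r + 1 := by omega
        subst hjr
        simp only [le_refl, if_true, Nat.sub_self, Nat.choose_zero_right, hj', if_false]
        push_cast
        ring
    · have hj' : ¬ j ≤ r := by omega
      simp only [hj, hj', if_false]
      push_cast
      ring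

/-- Propagation: if `Φ_j^{(L)}` is two-point log-concave then so is `Φ_j^{(L+1)}`. -/
theorem phi_lc2_succ (L j : ℕ)
    (h : ∀ m m', m ≤ m' →
      ((L.choose m : ℝ) + (if j ≤ m then (L.choose (m - j) : ℝ) else 0)) *
        ((L.choose (m' + 1) : ℝ) + (if j ≤ m' + 1 then (L.choose (m' + 1 - j) : ℝ) else 0)) ≤
      ((L.choose (m + 1) : ℝ) + (if j ≤ m + 1 then (L.choose (m + 1 - j) : ℝ) else 0)) *
        ((L.choose m' : ℝ) + (if j ≤ m' then (L.choose (m' - j) : ℝ) else 0))) :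
    ∀ m m', m ≤ m' →
      (((L + 1).choose m : ℝ) + (if j ≤ m then ((L + 1).choose (m - j) : ℝ) else 0)) *
        (((L + 1).choose (m' + 1) : ℝ) + (if j ≤ m' + 1 then ((L + 1).choose (m' + 1 - j) : ℝ) else 0)) ≤
      (((L + 1).choose (m + 1) : ℝ) + (if j ≤ m + 1 then ((L + 1).choose (m + 1 - j) : ℝ) else 0)) *
        (((L + 1).choose m' : ℝ) + (if j ≤ m' then ((L + 1).choose (m' - j) : ℝ) else 0)) := by
  intro m m' hmm'
  rw [phi_succ L j m, phi_succ L j (m' + 1), phi_succ L j (m + 1), phi_succ L j m']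
  exact ULCTwo.window_lc2 (fun t => (L.choose t : ℝ) + (if j ≤ t then (L.choose (t - j) : ℝ) else 0))
    (fun t => TwoLevel.phi_nonneg L j t) h 1 m m' hmm'

/-- Induction on `L` from a base `L₀`. -/
theorem phi_lc2_of_base (L₀ j : ℕ)
    (hbase : ∀ m m', m ≤ m' →
      ((L₀.choose m : ℝ) + (if j ≤ m then (L₀.choose (m - j) : ℝ) else 0)) *
        ((L₀.choose (m' + 1) : ℝ) + (if j ≤ m' + 1 then (L₀.choose (m' + 1 - j) : ℝ) else 0)) ≤
      ((L₀.choose (m + 1) : ℝ) + (if j ≤ m + 1 then (L₀.choose (m + 1 - j) : ℝ) else 0)) *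
        ((L₀.choose m' : ℝ) + (if j ≤ m' then (L₀.choose (m' - j) : ℝ) else 0))) :
    ∀ d L, L = L₀ + d → ∀ m m', m ≤ m' →
      ((L.choose m : ℝ) + (if j ≤ m then (L.choose (m - j) : ℝ) else 0)) *
        ((L.choose (m' + 1) : ℝ) + (if j ≤ m' + 1 then (L.choose (m' + 1 - j) : ℝ) else 0)) ≤
      ((L.choose (m + 1) : ℝ) + (if j ≤ m + 1 then (L.choose (m + 1 - j) : ℝ) else 0)) *
        ((L.choose m' : ℝ) + (if j ≤ m' then (L.choose (m' - j) : ℝ) else 0)) := by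
  intro d
  induction d with
  | zero =>
    intro L hL
    subst hL
    simpa using hbase
  | succ d ih =>
    intro L hL
    have e : L = (L₀ + d) + 1 := by omega
    rw [e]
    exact phi_lc2_succ (L₀ + d) j (ih (L₀ + d) rfl)

/-- From a two-point inequality over `ℕ` to the real form of the hypothesis. -/
theorem phi_lc2_real_of_nat (L j : ℕ)
    (h : ∀ m m', m ≤ m' →
      (L.choose m + (if j ≤ m then L.choose (m - j) else 0)) *
        (L.choose (m' + 1) + (if j ≤ m' + 1 then L.choose (m' + 1 - j) else 0)) ≤
      (L.choose (m + 1) + (if j ≤ m + 1 then L.choose (m + 1 - j) else 0)) *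
        (L.choose m' + (if j ≤ m' then L.choose (m' - j) else 0)))
    (m m' : ℕ) (hmm' : m ≤ m') :
    ((L.choose m : ℝ) + (if j ≤ m then (L.choose (m - j) : ℝ) else 0)) *
        ((L.choose (m' + 1) : ℝ) + (if j ≤ m' + 1 then (L.choose (m' + 1 - j) : ℝ) else 0)) ≤
      ((L.choose (m + 1) : ℝ) + (if j ≤ m + 1 then (L.choose (m + 1 - j) : ℝ) else 0)) *
        ((L.choose m' : ℝ) + (if j ≤ m' then (L.choose (m' - j) : ℝ) else 0)) := by
  have hc : ∀ t : ℕ, ((L.choose t : ℝ) + (if j ≤ t then (L.choose (t - j) : ℝ) else 0)) =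
      ((L.choose t + (if j ≤ t then L.choose (t - j) else 0) : ℕ) : ℝ) := by
    intro t
    split_ifs <;> push_cast <;> ring
  rw [hc m, hc (m' + 1), hc (m + 1), hc m']
  exact_mod_cast h m m' hmm'

/-- Beyond the support the two-point inequality is trivial: for `m' ≥ L + j` the factor `Φ(m'+1)` vanishes. -/
theorem phi_lc2_nat_large (L j m m' : ℕ) (hm' : L + j ≤ m') :
    (L.choose m + (if j ≤ m then L.choose (m - j) else 0)) *
        (L.choose (m' + 1) + (if j ≤ m' + 1 then L.choose (m' + 1 - j) else 0)) ≤
      (L.choose (m + 1) + (if j ≤ m + 1 then L.choose (m + 1 - j) else 0)) *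
        (L.choose m' + (if j ≤ m' then L.choose (m' - j) else 0)) := by
  have h1 : L.choose (m' + 1) = 0 := Nat.choose_eq_zero_of_lt (by omega)
  have h2 : (if j ≤ m' + 1 then L.choose (m' + 1 - j) else 0) = 0 := by
    rw [if_pos (by omega)]
    exact Nat.choose_eq_zero_of_lt (by omega)
  rw [h1, h2]
  simp

/-- Base case `j = 3`, `L₀ = 6`, finite part (`Φ = (1,6,15,21,21,21,21,15,6,1)`), by `decide`. -/
theorem phi_lc2_three_fin : ∀ m, m < 9 → ∀ m', m' < 9 → m ≤ m' →
    ((6 : ℕ).choose m + (if 3 ≤ m then (6 : ℕ).choose (m - 3) else 0)) *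
        ((6 : ℕ).choose (m' + 1) + (if 3 ≤ m' + 1 then (6 : ℕ).choose (m' + 1 - 3) else 0)) ≤
      ((6 : ℕ).choose (m + 1) + (if 3 ≤ m + 1 then (6 : ℕ).choose (m + 1 - 3) else 0)) *
        ((6 : ℕ).choose m' + (if 3 ≤ m' then (6 : ℕ).choose (m' - 3) else 0)) := by
  decide

/-- Base case `j = 3`, `L₀ = 6`: `Φ_3^{(6)}` is two-point log-concave (over `ℕ`). -/
theorem phi_lc2_three_base : ∀ m m', m ≤ m' →
    ((6 : ℕ).choose m + (if 3 ≤ m then (6 : ℕ).choose (m - 3) else 0)) *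
        ((6 : ℕ).choose (m' + 1) + (if 3 ≤ m' + 1 then (6 : ℕ).choose (m' + 1 - 3) else 0)) ≤
      ((6 : ℕ).choose (m + 1) + (if 3 ≤ m + 1 then (6 : ℕ).choose (m + 1 - 3) else 0)) *
        ((6 : ℕ).choose m' + (if 3 ≤ m' then (6 : ℕ).choose (m' - 3) else 0)) := by
  intro m m' hmm'
  rcases le_or_gt (6 + 3) m' with hbig | hsmall
  · exact phi_lc2_nat_large 6 3 m m' hbig
  · exact phi_lc2_three_fin m (by omega) m' (by omega) hmm'

/-- Base case `j = 4`, `L₀ = 13`, finite part, by `decide`. -/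
theorem phi_lc2_four_fin : ∀ m, m < 17 → ∀ m', m' < 17 → m ≤ m' →
    ((13 : ℕ).choose m + (if 4 ≤ m then (13 : ℕ).choose (m - 4) else 0)) *
        ((13 : ℕ).choose (m' + 1) + (if 4 ≤ m' + 1 then (13 : ℕ).choose (m' + 1 - 4) else 0)) ≤
      ((13 : ℕ).choose (m + 1) + (if 4 ≤ m + 1 then (13 : ℕ).choose (m + 1 - 4) else 0)) *
        ((13 : ℕ).choose m' + (if 4 ≤ m' then (13 : ℕ).choose (m' - 4) else 0)) := by
  decide

/-- Base case `j = 4`, `L₀ = 13`: `Φ_4^{(13)}` is two-point log-concave (over `ℕ`). -/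
theorem phi_lc2_four_base : ∀ m m', m ≤ m' →
    ((13 : ℕ).choose m + (if 4 ≤ m then (13 : ℕ).choose (m - 4) else 0)) *
        ((13 : ℕ).choose (m' + 1) + (if 4 ≤ m' + 1 then (13 : ℕ).choose (m' + 1 - 4) else 0)) ≤
      ((13 : ℕ).choose (m + 1) + (if 4 ≤ m + 1 then (13 : ℕ).choose (m + 1 - 4) else 0)) *
        ((13 : ℕ).choose m' + (if 4 ≤ m' then (13 : ℕ).choose (m' - 4) else 0)) := by
  intro m m' hmm'
  rcases le_or_gt (13 + 4) m' with hbig | hsmall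
  · exact phi_lc2_nat_large 13 4 m m' hbig
  · exact phi_lc2_four_fin m (by omega) m' (by omega) hmm'

/-- `Φ_3^{(L)}` is two-point log-concave for `L ≥ 6`. -/
theorem phi_lc2_three (L : ℕ) (hL : 6 ≤ L) (m m' : ℕ) (h : m ≤ m') :
    ((L.choose m : ℝ) + (if 3 ≤ m then (L.choose (m - 3) : ℝ) else 0)) *
        ((L.choose (m' + 1) : ℝ) + (if 3 ≤ m' + 1 then (L.choose (m' + 1 - 3) : ℝ) else 0)) ≤
      ((L.choose (m + 1) : ℝ) + (if 3 ≤ m + 1 then (L.choose (m + 1 - 3) : ℝ) else 0)) *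
        ((L.choose m' : ℝ) + (if 3 ≤ m' then (L.choose (m' - 3) : ℝ) else 0)) :=
  phi_lc2_of_base 6 3 (fun a b hab => phi_lc2_real_of_nat 6 3 phi_lc2_three_base a b hab)
    (L - 6) L (by omega) m m' h

/-- `Φ_4^{(L)}` is two-point log-concave for `L ≥ 13`. -/
theorem phi_lc2_four (L : ℕ) (hL : 13 ≤ L) (m m' : ℕ) (h : m ≤ m') :
    ((L.choose m : ℝ) + (if 4 ≤ m then (L.choose (m - 4) : ℝ) else 0)) *
        ((L.choose (m' + 1) : ℝ) + (if 4 ≤ m' + 1 then (L.choose (m' + 1 - 4) : ℝ) else 0)) ≤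
      ((L.choose (m + 1) : ℝ) + (if 4 ≤ m + 1 then (L.choose (m + 1 - 4) : ℝ) else 0)) *
        ((L.choose m' : ℝ) + (if 4 ≤ m' then (L.choose (m' - 4) : ℝ) else 0)) :=
  phi_lc2_of_base 13 4 (fun a b hab => phi_lc2_real_of_nat 13 4 phi_lc2_four_base a b hab)
    (L - 13) L (by omega) m m' h

/-- **THEOREM U-LC for `j = 3` (unconditional, `L ≥ 6`).**  With `2K + 3 = M₁+M₂+L`, `κ ≥ 0`,
`κ N(N-1) ≥ M₁M₂(N-9)` and symmetric unimodal tilts, the tilted two-block sum is nonnegative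
(the tilted TEST(3) inequality). -/
theorem u_lc_kappa_three (M₁ M₂ L K : ℕ) (hL : 6 ≤ L) (hN : 2 * K + 3 = M₁ + M₂ + L) (κ : ℝ) (hκ : 0 ≤ κ)
    (hκ₀ : (M₁ : ℝ) * M₂ * (((M₁ + M₂ + L : ℕ) : ℝ) - (((M₁ + M₂ + L : ℕ) : ℝ) - 2 * K) ^ 2) ≤
      κ * (((M₁ + M₂ + L : ℕ) : ℝ) * (((M₁ + M₂ + L : ℕ) : ℝ) - 1)))
    (w₁ w₂ : ℕ → ℝ) (hw₁nn : ∀ x, 0 ≤ w₁ x)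
    (hw₁sym : ∀ x, x ≤ M₁ → w₁ x = w₁ (M₁ - x)) (hw₁uni : ∀ x, 2 * x + 2 ≤ M₁ → w₁ x ≤ w₁ (x + 1))
    (hw₂nn : ∀ x, 0 ≤ w₂ x)
    (hw₂sym : ∀ x, x ≤ M₂ → w₂ x = w₂ (M₂ - x)) (hw₂uni : ∀ x, 2 * x + 2 ≤ M₂ → w₂ x ≤ w₂ (x + 1)) :
    0 ≤ ∑ x₁ ∈ range (M₁ + 1), ∑ x₂ ∈ range (M₂ + 1),
        (M₁.choose x₁ : ℝ) * w₁ x₁ * ((M₂.choose x₂ : ℝ) * w₂ x₂) *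
          (if x₁ + x₂ ≤ K then (L.choose (K - (x₁ + x₂)) : ℝ) else 0) *
          (κ + (2 * (x₁ : ℝ) - M₁) * (2 * (x₂ : ℝ) - M₂)) :=
  ULCKappa.u_lc_kappa M₁ M₂ L K 3 hN κ hκ hκ₀ w₁ w₂ hw₁nn hw₁sym hw₁uni hw₂nn hw₂sym hw₂uni
    (fun m m' h => phi_lc2_three L hL m m' h)

/-- **THEOREM U-LC for `j = 4` (unconditional, `L ≥ 13`).**  With `2K + 4 = M₁+M₂+L`, `κ ≥ 0`,
`κ N(N-1) ≥ M₁M₂(N-16)` and symmetric unimodal tilts, the tilted two-block sum is nonnegative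
(the tilted TEST(4) inequality). -/
theorem u_lc_kappa_four (M₁ M₂ L K : ℕ) (hL : 13 ≤ L) (hN : 2 * K + 4 = M₁ + M₂ + L) (κ : ℝ) (hκ : 0 ≤ κ)
    (hκ₀ : (M₁ : ℝ) * M₂ * (((M₁ + M₂ + L : ℕ) : ℝ) - (((M₁ + M₂ + L : ℕ) : ℝ) - 2 * K) ^ 2) ≤
      κ * (((M₁ + M₂ + L : ℕ) : ℝ) * (((M₁ + M₂ + L : ℕ) : ℝ) - 1)))
    (w₁ w₂ : ℕ → ℝ) (hw₁nn : ∀ x, 0 ≤ w₁ x)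
    (hw₁sym : ∀ x, x ≤ M₁ → w₁ x = w₁ (M₁ - x)) (hw₁uni : ∀ x, 2 * x + 2 ≤ M₁ → w₁ x ≤ w₁ (x + 1))
    (hw₂nn : ∀ x, 0 ≤ w₂ x)
    (hw₂sym : ∀ x, x ≤ M₂ → w₂ x = w₂ (M₂ - x)) (hw₂uni : ∀ x, 2 * x + 2 ≤ M₂ → w₂ x ≤ w₂ (x + 1)) :
    0 ≤ ∑ x₁ ∈ range (M₁ + 1), ∑ x₂ ∈ range (M₂ + 1),
        (M₁.choose x₁ : ℝ) * w₁ x₁ * ((M₂.choose x₂ : ℝ) * w₂ x₂) *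
          (if x₁ + x₂ ≤ K then (L.choose (K - (x₁ + x₂)) : ℝ) else 0) *
          (κ + (2 * (x₁ : ℝ) - M₁) * (2 * (x₂ : ℝ) - M₂)) :=
  ULCKappa.u_lc_kappa M₁ M₂ L K 4 hN κ hκ hκ₀ w₁ w₂ hw₁nn hw₁sym hw₁uni hw₂nn hw₂sym hw₂uni
    (fun m m' h => phi_lc2_four L hL m m' h)

end ULCSmallJ

end Summit.CriticalPhenomena.PercolationContinuityZ3.Theorems
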